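import Summits.QuantumFields.BalabanUV.T4Continuum.Support.GaugeTermBalabanData

/-!
# T⁴ programme, spine node NE2 (U1a), owner row B8 «general rate» (OWNER RULING NE2 R17 (c); closer (M1′) of GAPS § G-ne2leaf08g2-1,
# STRUCTURE half), PART 3b, file 1/2 — THE GAUGE SLOT's NUMBER SEQUENCES AND LEAF-08's SLOT LAW AT A GENERAL GEOMETRIC RATE `θ ∈ [L⁻¹, 1]`

NE2 formalisation swarm `b2b-balaban-t4-ne2-formalise-*`, leaf prover 05 (gen 4; the lineage of row B4.b).  APPEND-ONLY TWINS — NO landed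
statement edited.  In the slot's chain at rate `L⁻¹` (`GaugeTermInstance.layerLaws_of_scalarLaws` → `GaugeTermInstanceGeom.geomNumbers_of_defects`
→ `NE2BalabanGauge.{EGT_le_geom, perturbationLaws_gaugeSlot}` → `GaugeTermInstanceGeom.perturbationLaws_gaugeSlot_scalar(_site)` →
`GaugeTermBalabanData.perturbationLaws_gaugeSlot_data`) the ratio `L⁻¹` is hard-wired only in the geometric READ-OUTS and in leaf-08's bundle
`GeomNumbers L`; the estimates underneath (`zetaL_le_geom`, `nuL_le_geom`, `GaugeTermSandwichLaw.Esand_le_geometric`) are ratio-GENERIC.  This file: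
 * §1 `const_mul_invPow_le_pow` (`C·L^{−k} ≤ C·θ^k` for `L⁻¹ ≤ θ`; cf. the owner's `NE2ColourPerturbedLayerRate.const_mul_invPow_le`),
   `esS_le_geom_rate`, `ecS_le_geom_rate`, the planting sequence **`thetaSR`** (`= ec k·d(L+1)Cst + g·d·Cst·(β′θ^k + 2(α+β)/n_k)`: leaf-10's
   per-level `planting_number_le` at the level-`k` two-spacing constant `β′θ^k·n_k`) and `thetaSR_le_geom … ≤ CthetaS·θ^k` (`L⁻¹ ≤ θ`);
 * §2 **`GeomNumbersRate θ …`** (leaf-08's `GeomNumbers` with ratio `θ`; `geomNumbersRate_of_geomNumbers` = the `θ = L⁻¹` instance),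
   **`EGT_le_geom_rate (hθ : L⁻¹ ≤ θ) (hθle : θ ≤ 1) … : EGT … k ≤ C4GT … · θ^k`** (leaf-08's constant `C4GT` UNCHANGED; the free King defects
   `2dCst·L^{−k}`, `CJ·L^{−k}` inside `EGT` majorised by `·θ^k`) and **`perturbationLaws_gaugeSlot_rate`** (leaf-08's `perturbationLaws_gaugeSlot`
   with ratio-`θ` numbers: `PerturbationLaws (Δ_a ⊗ 1) (gaugeSlot R Qu Q₁ a′) (J ⊗ 1) (kappaGT …) (k ↦ C4GT … · θ^k)`).
File 2/2 (`GaugeTermSlotRate`) builds the `LayerLaws` with a rate-`θ` connection consistency and the ENDs.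

HONEST FRAMING (T4-DAG p. 1).  Real-arithmetic bookkeeping at MODEL LEVEL; constants OURS; nothing of node NE3; no B0 (c5); ROOT B CONDITIONAL
exactly as before; NE2 (U1a) NOT proved; spine PROVED 0/9 unchanged; rung (B)+1 on one finite T⁴ — NOT infinite volume, NOT mass gap, NOT Clay.
HONEST DEPENDENCY: continuum YM on T⁴ ⇐ BetaPertH ∧ nine spine estimates (0/9 proved); BetaPertH ⇐ (D1) ∧ (D4) ∧ CAP+tail; G-an2-4 gates
asym, D1 and NE2/3/4.  ABSOLUTE RULE kept; `GeomNumbersRate` is a hypothesis SHAPE on number sequences (`structure … : Prop`), no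
`def … : Prop` fact; no `sorry`.
-/

noncomputable section

open scoped BigOperators ComplexConjugate Matrix Matrix.Norms.L2Operator Kronecker ComplexOrder

namespace Summit.QuantumFields.BalabanUV.T4Continuum.GaugeTermSlotRateNumbers

open Literature.MathematicalPhysics.QuantumFieldTheory.Balaban1983to89.B5Prop11Plancherel
open Literature.MathematicalPhysics.QuantumFieldTheory.Balaban1983to89.B5G183RateUnitTower (lev lev_neZero)
open Summit.QuantumFields.BalabanUV.T4Continuum
open Summit.QuantumFields.BalabanUV.T4Continuum.BalabanAveragedTowerUnit (idx Qlev one_le_lev' cast_lev')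
open Summit.QuantumFields.BalabanUV.T4Continuum.BackgroundResolventTower
open Summit.QuantumFields.BalabanUV.T4Continuum.BackgroundResolventLaw
open Summit.QuantumFields.BalabanUV.T4Continuum.KingPairingPlantedLaw
open Summit.QuantumFields.BalabanUV.T4Continuum.KroneckerLift
open Summit.QuantumFields.BalabanUV.T4Continuum.BlockMultiplication
open Summit.QuantumFields.BalabanUV.T4Continuum.BalabanAveragedTowerModes (par)
open Summit.QuantumFields.BalabanUV.T4Continuum.PerturbationAlgebra (perturbationLaws_mono perturbationLaws_zero)
open Summit.QuantumFields.BalabanUV.T4Continuum.GaugeTermDecomposition (covGrad defect connL opNorm_defect_le)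
open Summit.QuantumFields.BalabanUV.T4Continuum.GaugeTermSandwichLaw
open Summit.QuantumFields.BalabanUV.T4Continuum.GaugeTermLayer
open Summit.QuantumFields.BalabanUV.T4Continuum.GaugeTermPerturbationLaw
open Summit.QuantumFields.BalabanUV.T4Continuum.GaugeTermScalarData
open Summit.QuantumFields.BalabanUV.T4Continuum.GaugeTermInstance
open Summit.QuantumFields.BalabanUV.T4Continuum.GaugeTermInstanceGeom (CesS CecS CthetaS gS kappaGS C4S inv_cast_lev J0_eq_kron_J0pcT
  opNorm_siteMul_sub_one_le opNorm_siteMul_sub_siteMul_le)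
open Summit.QuantumFields.BalabanUV.T4Continuum.GaugeTermBalabanData (C4data connL_bound connL_lipschitz)
open Summit.QuantumFields.BalabanUV.T4Continuum.ScalarAveragedPropagator (DeltaPs Gps gammaPs gammaPs_pos)
open Summit.QuantumFields.BalabanUV.T4Continuum.ScalarAveragedCompression (sigma0)
open Summit.QuantumFields.BalabanUV.T4Continuum.ScalarCovariantLaplacian (Bs connS scalarPert kappaS opNorm_Bs_le)
open Summit.QuantumFields.BalabanUV.T4Continuum.ScalarCovariantLaplacianLaws (C2S)
open Summit.QuantumFields.BalabanUV.T4Continuum.ScalarPlantingDefect (Q0lev J0pcT)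
open Summit.QuantumFields.BalabanUV.T4Continuum.EffectiveLaplacianExcess (CX freeTowerLaws_king_scalar)
open Summit.QuantumFields.BalabanUV.T4Continuum.BlockPairingGeometry (tau parT)
open Summit.QuantumFields.BalabanUV.T4Continuum.CovariantDivergencePlantingTower (JK0T JK0T_eq Pi0T planting_number_le)
open Summit.QuantumFields.BalabanUV.T4Continuum.NE2BalabanGauge

/-! ## §1 The number sequences at rate `θ` -/

section Numbers

variable {d L : ℕ} {a g α β β' κs θ : ℝ} {e₀ e₁ e₂ δT : ℕ → ℝ} {C₀ C₁ C₂ CT : ℝ}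

/-- `C·L^{−k} ≤ C·θ^k` for `C ≥ 0` and `L⁻¹ ≤ θ` (the free King defects feed the rate-`θ` bookkeeping; cf. the owner's
`NE2ColourPerturbedLayerRate.const_mul_invPow_le`). [folklore] -/
theorem const_mul_invPow_le_pow {C θ : ℝ} (hC : 0 ≤ C) (hθ : ((L : ℝ)⁻¹) ≤ θ) (k : ℕ) : C * ((L : ℝ)⁻¹) ^ k ≤ C * θ ^ k :=
  mul_le_mul_of_nonneg_left (pow_le_pow_left₀ (inv_nonneg.mpr (Nat.cast_nonneg L)) hθ k) hC

/-- `esS ≤ CesS·θ^k`. [folklore] -/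
theorem esS_le_geom_rate (he₁ : ∀ k, e₁ k ≤ C₁ * θ ^ k) (he₂ : ∀ k, e₂ k ≤ C₂ * θ ^ k) (k : ℕ) :
    esS κs e₁ e₂ k ≤ CesS κs C₁ C₂ * θ ^ k := by
  have hν : 0 ≤ ((1 - κs)⁻¹) ^ 2 := sq_nonneg _
  unfold esS CesS
  calc (e₁ k + e₂ k) * ((1 - κs)⁻¹) ^ 2 ≤ ((C₁ + C₂) * θ ^ k) * ((1 - κs)⁻¹) ^ 2 :=
        mul_le_mul_of_nonneg_right (by have := he₁ k; have := he₂ k; linarith) hν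
    _ = (C₁ + C₂) * ((1 - κs)⁻¹) ^ 2 * θ ^ k := by ring

/-- `ecS ≤ CecS·θ^k`. [folklore] -/
theorem ecS_le_geom_rate (hκ : κs < 1) (he₀ : ∀ k, e₀ k ≤ C₀ * θ ^ k) (k : ℕ) : ecS κs e₀ k ≤ CecS κs C₀ * θ ^ k := by
  have hν : 0 ≤ (1 - κs)⁻¹ := inv_nonneg.mpr (by linarith)
  unfold ecS CecS
  rw [mul_assoc]
  exact mul_le_mul_of_nonneg_left (he₀ k) hν

/-- the sandwiched covariant-divergence planting sequence AT RATE `θ`: `θ_k = ec k·d(L+1)Cst + g·d·Cst·(β′θ^k + 2(α+β)/n_k)` — leaf-10's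
`planting_number_le` at level `k` with the two-spacing constant `β′θ^k·n_k` (`GaugeTermInstance.thetaS` is the case `β′θ^k = β′/n_k`). [folklore] -/
def thetaSR (d L : ℕ) (a g α β β' θ : ℝ) (ec : ℕ → ℝ) (k : ℕ) : ℝ :=
  ec k * (d * ((L : ℝ) + 1) * Cst d a) + g * (d * Cst d a * (β' * θ ^ k + 2 * (α + β) / (lev L k : ℕ)))

/-- `thetaSR … ec ≤ CthetaS·θ^k` for `ec ≤ Cec·θ^k`, `L⁻¹ ≤ θ` (`1/n_k = L⁻¹^k ≤ θ^k`) and `g, α, β ≥ 0`. [folklore] -/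
theorem thetaSR_le_geom [NeZero L] {ec : ℕ → ℝ} {Cec : ℝ} (hg : 0 ≤ g) (hα : 0 ≤ α) (hβ : 0 ≤ β) (hθ : ((L : ℝ)⁻¹) ≤ θ)
    (hec : ∀ k, ec k ≤ Cec * θ ^ k) (k : ℕ) :
    thetaSR d L a g α β β' θ ec k ≤ CthetaS d L a g α β β' Cec * θ ^ k := by
  have hC := Cst_nonneg d a
  have h1 : 0 ≤ d * ((L : ℝ) + 1) * Cst d a := by positivity
  have h3 : ec k * (d * ((L : ℝ) + 1) * Cst d a) ≤ (Cec * θ ^ k) * (d * ((L : ℝ) + 1) * Cst d a) :=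
    mul_le_mul_of_nonneg_right (hec k) h1
  have hinv : 2 * (α + β) / (lev L k : ℕ) ≤ 2 * (α + β) * θ ^ k := by
    rw [div_eq_mul_inv, inv_cast_lev]
    exact const_mul_invPow_le_pow (L := L) (by positivity) hθ k
  have h4 : g * (d * Cst d a * (β' * θ ^ k + 2 * (α + β) / (lev L k : ℕ))) ≤ g * (d * Cst d a * (β' * θ ^ k + 2 * (α + β) * θ ^ k)) :=
    mul_le_mul_of_nonneg_left (mul_le_mul_of_nonneg_left (add_le_add le_rfl hinv) (by positivity)) hg
  unfold thetaSR CthetaS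
  calc ec k * (d * ((L : ℝ) + 1) * Cst d a) + g * (d * Cst d a * (β' * θ ^ k + 2 * (α + β) / (lev L k : ℕ)))
      ≤ (Cec * θ ^ k) * (d * ((L : ℝ) + 1) * Cst d a) + g * (d * Cst d a * (β' * θ ^ k + 2 * (α + β) * θ ^ k)) := add_le_add h3 h4
    _ = (Cec * (d * ((L : ℝ) + 1) * Cst d a) + g * (d * ((β' + 2 * (α + β)) * Cst d a))) * θ ^ k := by ring

end Numbers

/-! ## §2 Leaf-08's geometric bundle and slot law at rate `θ` -/

section GeomRate

variable {d L : ℕ} {a g q α τ a' n₁ : ℝ} {esu ecu θu q₁u es₁ ec₁ θ₁ q₁₁ : ℕ → ℝ}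

/-- the bundle of GEOMETRIC BOUNDS AT RATIO `θ` on one family's four number sequences of `LayerLaws`, with their nonnegativity
(`NE2BalabanGauge.GeomNumbers L` is the case `θ = L⁻¹`).  A hypothesis SHAPE on data; asserted by nobody. [folklore] -/
structure GeomNumbersRate (θ : ℝ) (es ec θs q₁ : ℕ → ℝ) (Ces Cec Cθ Cq : ℝ) : Prop where
  es_nonneg : ∀ k, 0 ≤ es k
  ec_nonneg : ∀ k, 0 ≤ ec k
  q₁_nonneg : ∀ k, 0 ≤ q₁ k
  es_le : ∀ k, es k ≤ Ces * θ ^ k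
  ec_le : ∀ k, ec k ≤ Cec * θ ^ k
  θ_le : ∀ k, θs k ≤ Cθ * θ ^ k
  q₁_le : ∀ k, q₁ k ≤ Cq * θ ^ k

/-- leaf-08's ratio-`L⁻¹` bundle is the `θ = L⁻¹` instance. [folklore] -/
theorem geomNumbersRate_of_geomNumbers {es ec θs q₁ : ℕ → ℝ} {Ces Cec Cθ Cq : ℝ} (h : GeomNumbers L es ec θs q₁ Ces Cec Cθ Cq) :
    GeomNumbersRate ((L : ℝ)⁻¹) es ec θs q₁ Ces Cec Cθ Cq :=
  ⟨h.es_nonneg, h.ec_nonneg, h.q₁_nonneg, h.es_le, h.ec_le, h.θ_le, h.q₁_le⟩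

/-- **`EGT ≤ C4GT·θ^k`** for `L⁻¹ ≤ θ ≤ 1`, nonnegative sizes and ratio-`θ` numbers of both families — leaf-08's `EGT_le_geom` with its
ratio-generic inputs (`zetaL_le_geom`, `nuL_le_geom`, `Esand_le_geometric`) run at `ρ = θ`; the free King defects `2dCst·L^{−k}`, `CJ·L^{−k}`
inside `EGT` are majorised by `·θ^k`; the constant `C4GT` is UNCHANGED. [folklore] -/
theorem EGT_le_geom_rate [NeZero L] {θ : ℝ} (hθ : ((L : ℝ)⁻¹) ≤ θ) (hθle : θ ≤ 1) (hq : 0 ≤ q) (hg : 0 ≤ g) (hα : 0 ≤ α)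
    (hn : 0 ≤ n₁ * (1 - n₁ * deltaK g q α τ a')⁻¹)
    {Cesu Cecu Cθu Cqu Ces₁ Cec₁ Cθ₁ Cq₁ : ℝ} (hGu : GeomNumbersRate θ esu ecu θu q₁u Cesu Cecu Cθu Cqu)
    (hG₁ : GeomNumbersRate θ es₁ ec₁ θ₁ q₁₁ Ces₁ Cec₁ Cθ₁ Cq₁) (k : ℕ) :
    EGT d L a g q α τ a' n₁ esu ecu θu q₁u es₁ ec₁ θ₁ q₁₁ k ≤ C4GT d a g q α τ a' n₁ Cesu Cecu Cθu Cqu Ces₁ Cec₁ Cθ₁ Cq₁ * θ ^ k := by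
  have hρ0 : (0 : ℝ) ≤ θ := (inv_nonneg.mpr (Nat.cast_nonneg L)).trans hθ
  have hC := Cst_nonneg d a
  have hz : 0 ≤ q * Real.sqrt g := mul_nonneg hq (Real.sqrt_nonneg g)
  have h0 : ∀ k, 2 * d * Cst d a * ((L : ℝ)⁻¹) ^ k ≤ 2 * d * Cst d a * θ ^ k := const_mul_invPow_le_pow (L := L) (by positivity) hθ
  have h1 : ∀ k, CJ d a * ((L : ℝ)⁻¹) ^ k ≤ CJ d a * θ ^ k := const_mul_invPow_le_pow (L := L) (CJ_nonneg d a) hθ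
  have eu := Esand_le_geometric (e₀ := fun k => 2 * d * Cst d a * ((L : ℝ)⁻¹) ^ k) (e₁ := fun k => CJ d a * ((L : ℝ)⁻¹) ^ k)
    hC hz hn (ζ := zetaL d a g q α esu θu q₁u) (ν := nuL g q (n₁ * (1 - n₁ * deltaK g q α τ a')⁻¹) esu ecu q₁u)
    (ρ := θ) (C₀ := 2 * d * Cst d a) (C₁ := CJ d a) (Cζ := CzetaL d a g q α Cesu Cθu Cqu)
    (Cν := CnuL g q (n₁ * (1 - n₁ * deltaK g q α τ a')⁻¹) Cesu Cecu Cqu) h0 h1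
    (zetaL_le_geom (d := d) (a := a) (g := g) hq hα hGu.es_le hGu.θ_le hGu.q₁_le)
    (nuL_le_geom hq hg hn hρ0 hθle hGu.es_nonneg hGu.q₁_nonneg hGu.ec_nonneg hGu.es_le hGu.ec_le hGu.q₁_le) k
  have e1 := Esand_le_geometric (e₀ := fun k => 2 * d * Cst d a * ((L : ℝ)⁻¹) ^ k) (e₁ := fun k => CJ d a * ((L : ℝ)⁻¹) ^ k)
    hC hz hn (ζ := zetaL d a g q α es₁ θ₁ q₁₁) (ν := nuL g q (n₁ * (1 - n₁ * deltaK g q α τ a')⁻¹) es₁ ec₁ q₁₁)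
    (ρ := θ) (C₀ := 2 * d * Cst d a) (C₁ := CJ d a) (Cζ := CzetaL d a g q α Ces₁ Cθ₁ Cq₁)
    (Cν := CnuL g q (n₁ * (1 - n₁ * deltaK g q α τ a')⁻¹) Ces₁ Cec₁ Cq₁) h0 h1
    (zetaL_le_geom (d := d) (a := a) (g := g) hq hα hG₁.es_le hG₁.θ_le hG₁.q₁_le)
    (nuL_le_geom hq hg hn hρ0 hθle hG₁.es_nonneg hG₁.q₁_nonneg hG₁.ec_nonneg hG₁.es_le hG₁.ec_le hG₁.q₁_le) k
  unfold EGT C4GT C4one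
  refine (add_le_add eu e1).trans (le_of_eq ?_)
  ring

end GeomRate

section SlotRate

variable {d : ℕ} (L : ℕ) [NeZero L] (M : Fin d → ℕ) [hM : ∀ μ, NeZero (M μ)] (a : ℝ) (ha : 0 < a)
variable {o : Type*} [Fintype o] [DecidableEq o] {γ : Type*} [Fintype γ] [DecidableEq γ]

/-- **ROW B4.b's END IN THE SLOT FORM AT RATE `θ`**: two `LayerLaws`, the transport size `τ`, the `U = 1` unit datum, `n₁δK < 1` and ratio-`θ`
numbers (`L⁻¹ ≤ θ ≤ 1`) give the target shape for `gaugeSlot` with `κ₄ = kappaGT …` and `C₄ = C4GT …` — leaf-08's `perturbationLaws_gaugeSlot`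
with `EGT_le_geom_rate` for `EGT_le_geom`. [folklore] -/
theorem perturbationLaws_gaugeSlot_rate {R : (k : ℕ) → Fin d → (Tor (fine (lev L k) M) → Matrix o o ℂ)}
    {Qu Q₁ : (k : ℕ) → Matrix γ (Tor (fine (lev L k) M) × o) ℂ} {a' : ℝ}
    {J₀ : (k : ℕ) → Matrix (Tor (fine (lev L (k + 1)) M) × o) (Tor (fine (lev L k) M) × o) ℂ}
    {g q α τ n₁ θ : ℝ} {esu ecu θu q₁u es₁ ec₁ θ₁ q₁₁ : ℕ → ℝ} {Cesu Cecu Cθu Cqu Ces₁ Cec₁ Cθ₁ Cq₁ : ℝ}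
    (hu : LayerLaws L M a ha R Qu a' J₀ g q α esu ecu θu q₁u) (h₁ : LayerLaws L M a ha (oneR L M (o := o)) Q₁ a' J₀ g q α es₁ ec₁ θ₁ q₁₁)
    (hτ : ∀ k, ‖Qu k - Q₁ k‖ ≤ τ)
    (hK₁ : ∀ k, IsUnit (Q₁ k * Gop L M (oneR L M (o := o)) Q₁ a' k * Gop L M (oneR L M (o := o)) Q₁ a' k * (Q₁ k)ᴴ).det)
    (hn₁ : ∀ k, ‖Nt L M (oneR L M (o := o)) Q₁ a' k‖ ≤ n₁) (hsmall : n₁ * deltaK g q α τ a' < 1)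
    (hθ : ((L : ℝ)⁻¹) ≤ θ) (hθle : θ ≤ 1)
    (hGu : GeomNumbersRate θ esu ecu θu q₁u Cesu Cecu Cθu Cqu) (hG₁ : GeomNumbersRate θ es₁ ec₁ θ₁ q₁₁ Ces₁ Cec₁ Cθ₁ Cq₁) :
    PerturbationLaws (fun k => calDalev L M a ha k ⊗ₖ (1 : Matrix o o ℂ)) (gaugeSlot L M R Qu Q₁ a')
      (fun k => JpcT L M k ⊗ₖ (1 : Matrix o o ℂ)) (kappaGT d a g q α τ a' n₁)
      (fun k => C4GT d a g q α τ a' n₁ Cesu Cecu Cθu Cqu Ces₁ Cec₁ Cθ₁ Cq₁ * θ ^ k) := by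
  have h := perturbationLaws_gaugeTerm L M a ha R Qu Q₁ a' J₀ hu h₁ hτ hK₁ hn₁ hsmall
  have hn₁0 : 0 ≤ n₁ := (norm_nonneg _).trans (hn₁ 0)
  have hδ0 : 0 ≤ n₁ * deltaK g q α τ a' := mul_nonneg hn₁0 ((norm_nonneg _).trans (opNorm_gramK_U_sub_le hu h₁ hτ 0))
  have hn : 0 ≤ n₁ * (1 - n₁ * deltaK g q α τ a')⁻¹ := mul_nonneg hn₁0 (inv_nonneg.mpr (by linarith))
  have hg : 0 ≤ g := (norm_nonneg _).trans (hu.opNorm_G_le 0)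
  exact perturbationLaws_neg (perturbationLaws_mono h le_rfl
    (EGT_le_geom_rate (L := L) hθ hθle hu.nonneg.2.1 hg hu.nonneg.2.2 hn hGu hG₁))

end SlotRate

end Summit.QuantumFields.BalabanUV.T4Continuum.GaugeTermSlotRateNumbers

end
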